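import Mathlib
import HarnessLib
import Summits.Ventures.LatticeQCDFlow.Exactness.NCMCGeneralSpaceAcceptanceHoeffding
import Summits.Ventures.LatticeQCDFlow.Exactness.NCMCGeneralSpacePinskerFloor

/-!
# Relative-error confidence for the reported acceptance: the Chernoff–Bennett–Bernstein tail on a general state space

HONEST FRAMING: exact (Metropolis-corrected) sampling algorithms for lattice gauge theory;
figures of merit are autocorrelation/cost numbers at stated couplings and volumes; no
continuum-physics claim.

Venture `LatticeQCDFlow` (cell pub-lqcd), topic `Exactness`; FANOUT row 13 (`eng-snf`, GEN-13).
NEW WORK of the cell (elementary: Mathlib's Chernoff bound `measure_ge_le_exp_mul_mgf`, the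
product rule `iIndepFun.mgf_sum₀` for moment generating functions, convexity of `exp`), not a
published result; nothing is cited as a fact (H. Chernoff 1952, G. Bennett 1962, S. Bernstein 1924,
W. Hoeffding 1963 named only).  Continuation of `NCMCGeneralSpaceAcceptanceHoeffding.lean`
(GEN-12: `|ᾱ_N − a_F(c)| ≥ t` has probability `≤ 2e^{−2Nt²}`), whose NOT-TYPED list named
"Bernstein-type (variance-sensitive) tails for the acceptance estimate".  The point: an acceptance
near `0` (or near `1`) is a RARE-EVENT frequency, and Hoeffding's radius `√(log(2/δ)/(2N))` is
useless for certifying `a_F(c) = 0.01` to 10 %; the bounds below scale with `a_F` itself.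
The algebraic step from Bennett's exponent to Bernstein's is GEN-12's calculus lemma
`three_mul_sq_sub_one_le` (`3(u−1)² ≤ (4+2u)(u log u − u + 1)`) of `NCMCGeneralSpacePinskerFloor.lean`,
reused, not re-proved.

## Setting and content

`μ` a probability law on records, `g : E → [0,1]` measurable with mean `a = E_μ g`, `N ≥ 1` i.i.d.
records `Measure.pi (fun _ : Fin N => μ)`, `X̄ = sampleMean g`, `t > 0`.

* `exp_mul_le_of_mem_Icc` (`e^{λx} ≤ 1 + x(e^{λ} − 1)` on `[0,1]`, convexity), **`mgf_le_exp_of_mem_Icc`**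
  (`E e^{λg} ≤ exp(a(e^{λ} − 1))`), `sq_div_le_bennettExponent`
  (`t²/(2(a + t/3)) ≤ (a + t) log(1 + t/a) − t`, from `three_mul_sq_sub_one_le`).
* **`measureReal_sampleMean_sub_ge_le_exp_bennett`** — CHERNOFF–BENNETT UPPER TAIL (`a > 0`):
  `μ^{⊗N}{X̄ − a ≥ t} ≤ exp(−N[(a + t) log(1 + t/a) − t])` (Chernoff at `λ = log(1 + t/a)`).
* **`measureReal_sampleMean_sub_ge_le_exp_bernstein`** — BERNSTEIN UPPER TAIL (`a ≥ 0`, the case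
  `a = 0` being degenerate): `μ^{⊗N}{X̄ − a ≥ t} ≤ exp(−N t²/(2(a + t/3)))`;
  **`measureReal_sub_sampleMean_ge_le_exp_bernstein`** — LOWER TAIL (the upper tail of `1 − g`):
  `μ^{⊗N}{a − X̄ ≥ t} ≤ exp(−N t²/(2(1 − a + t/3)))`.
* For a Crooks pair `(κF, κR, s, e, W)` from `ν₀` to `ν₁`, a level constant `c`, the acceptance
  probabilities `α_i = min(1, e^{−(W_i − c)}) ∈ [0,1]` of `N` independent forward evolutions and
  their population mean `a_F(c)`: **`CrooksPair.measureReal_sampleMean_accept_sub_ge_le_exp`** /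
  **`CrooksPair.measureReal_accept_sub_sampleMean_ge_le_exp`** (the two Bernstein tails) and
  **`CrooksPair.measureReal_sampleMean_accept_ge_mul_le_exp`** — RELATIVE-ERROR FORM:
  `P{ᾱ_N ≥ (1 + ε) a_F(c)} ≤ exp(−N a_F(c) ε² / (2(1 + ε/3)))`.
  Reading for the engine (boarded `acceptance`, planted-control checks, `ncmc.c` pilots): to
  certify a reported acceptance to RELATIVE accuracy `ε` with confidence `1 − δ` it suffices that
  `N a_F(c) ≥ 2(1 + ε/3) log(1/δ)/ε²` — the number of ACCEPTED proposals, not of proposals, is what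
  must be large; Hoeffding would ask `N a_F(c)² ≳ log(1/δ)/ε²`.

Scope / NOT CLAIMED: independent evolutions only; the true variance `Var_F[α] ≤ a_F(1 − a_F)` is
not used (these are the `[0,1]`-Chernoff bounds, variance-sensitive through `a_F` and `1 − a_F`
only); no value for any concrete protocol.
-/

namespace Summit.Ventures.LatticeQCDFlow.Exactness.GeneralNCMC

open MeasureTheory ProbabilityTheory Set Filter Finset
open scoped ENNReal NNReal Topology

variable {E : Type*} [MeasurableSpace E]

/-! ## Elementary inequalities -/

/-- Convexity of `exp` on `[0,1]`: `e^{λx} ≤ 1 + x(e^{λ} − 1)` for `x ∈ [0,1]`. -/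
theorem exp_mul_le_of_mem_Icc {x : ℝ} (hx : x ∈ Icc (0 : ℝ) 1) (t : ℝ) :
    Real.exp (t * x) ≤ 1 + x * (Real.exp t - 1) := by
  have h := convexOn_exp.2 (mem_univ 0) (mem_univ t) (sub_nonneg.2 hx.2) hx.1 (by ring)
  simp only [smul_eq_mul, mul_zero, zero_add, Real.exp_zero, mul_one] at h
  rw [mul_comm]
  linarith

/-- … hence `e^{λx} ≤ max(1, e^{λ})` on `[0,1]` (a convex combination of `1` and `e^{λ}`). -/
theorem exp_mul_le_max_of_mem_Icc {x : ℝ} (hx : x ∈ Icc (0 : ℝ) 1) (t : ℝ) :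
    Real.exp (t * x) ≤ max 1 (Real.exp t) := by
  refine (exp_mul_le_of_mem_Icc hx t).trans ?_
  have h1 : (1 : ℝ) ≤ max 1 (Real.exp t) := le_max_left _ _
  have h2 : Real.exp t ≤ max 1 (Real.exp t) := le_max_right _ _
  nlinarith [hx.1, hx.2]

/-- **Bernstein from Bennett**: `t²/(2(a + t/3)) ≤ (a + t) log(1 + t/a) − t` for `a > 0`, `t ≥ 0`
(GEN-12's `three_mul_sq_sub_one_le` at `u = 1 + t/a`). -/
theorem sq_div_le_bennettExponent {a t : ℝ} (ha : 0 < a) (ht : 0 ≤ t) :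
    t ^ 2 / (2 * (a + t / 3)) ≤ (a + t) * Real.log (1 + t / a) - t := by
  obtain ⟨s, rfl⟩ : ∃ s, t = a * s := ⟨t / a, by field_simp⟩
  have hs : 0 ≤ s := (mul_nonneg_iff_of_pos_left ha).1 ht
  have h3 := three_mul_sq_sub_one_le (u := 1 + s) (by linarith)
  rw [add_sub_cancel_left] at h3
  rw [mul_div_cancel_left₀ s ha.ne',
    show (a + a * s) * Real.log (1 + s) - a * s = a * ((1 + s) * Real.log (1 + s) - (1 + s) + 1) by
      ring,
    div_le_iff₀ (by positivity)]
  nlinarith [mul_le_mul_of_nonneg_left h3 (sq_nonneg a)]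

section IID

variable (μ : Measure E) [IsProbabilityMeasure μ]

/-- **MGF bound for a `[0,1]`-valued observable**: `E_μ e^{λg} ≤ exp(a(e^{λ} − 1))`, `a = E_μ g`
(convexity of `exp`, then `1 + x ≤ e^{x}`). -/
theorem mgf_le_exp_of_mem_Icc {g : E → ℝ} (hg : Measurable g) (h01 : ∀ a, g a ∈ Icc (0 : ℝ) 1)
    (t : ℝ) : mgf g μ t ≤ Real.exp ((∫ a, g a ∂μ) * (Real.exp t - 1)) := by
  have hint : Integrable g μ := Integrable.of_mem_Icc 0 1 hg.aemeasurable (Eventually.of_forall h01)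
  have hexp : Integrable (fun a => Real.exp (t * g a)) μ :=
    Integrable.of_bound (Real.measurable_exp.comp (hg.const_mul t)).aestronglyMeasurable
      (max 1 (Real.exp t)) (Eventually.of_forall fun a => by
        rw [Real.norm_eq_abs, abs_of_nonneg (Real.exp_pos _).le]
        exact exp_mul_le_max_of_mem_Icc (h01 a) t)
  have hlin : Integrable (fun a => 1 + g a * (Real.exp t - 1)) μ :=
    (integrable_const 1).add (hint.mul_const _)
  calc mgf g μ t = ∫ a, Real.exp (t * g a) ∂μ := rfl
    _ ≤ ∫ a, (1 + g a * (Real.exp t - 1)) ∂μ :=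
        integral_mono hexp hlin fun a => exp_mul_le_of_mem_Icc (h01 a) t
    _ = 1 + (∫ a, g a ∂μ) * (Real.exp t - 1) := by
        rw [integral_add (integrable_const 1) (hint.mul_const _), integral_const, smul_eq_mul,
          probReal_univ, one_mul, integral_mul_const]
    _ ≤ Real.exp ((∫ a, g a ∂μ) * (Real.exp t - 1)) := by
        linarith [Real.add_one_le_exp ((∫ a, g a ∂μ) * (Real.exp t - 1))]

/-! ## Chernoff–Bennett and Bernstein tails for the sample mean of `N` i.i.d. records -/

/-- **Chernoff–Bennett upper tail**: for a measurable `g` with values in `[0,1]` and mean `a > 0`,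
`N ≥ 1` i.i.d. records and `t > 0`,
`μ^{⊗N} {(1/N) Σ_i g(y i) − a ≥ t} ≤ exp(−N[(a + t) log(1 + t/a) − t])`. -/
theorem measureReal_sampleMean_sub_ge_le_exp_bennett {g : E → ℝ} (hg : Measurable g)
    (h01 : ∀ a, g a ∈ Icc (0 : ℝ) 1) {N : ℕ} (hN : 0 < N) {t : ℝ} (ht : 0 < t)
    (ha : 0 < ∫ a, g a ∂μ) :
    (Measure.pi fun _ : Fin N => μ).real {y | t ≤ sampleMean g y - ∫ a, g a ∂μ} ≤
      Real.exp (-(N * (((∫ a, g a ∂μ) + t) * Real.log (1 + t / ∫ a, g a ∂μ) - t))) := by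
  set P := Measure.pi fun _ : Fin N => μ with hP
  set a := ∫ x, g x ∂μ with hadef
  set l := Real.log (1 + t / a) with hl
  have hl0 : 0 < l := Real.log_pos (by rw [lt_add_iff_pos_right]; positivity)
  have hexpl : Real.exp l = 1 + t / a := Real.exp_log (by positivity)
  -- independence and the one-coordinate MGF bound
  have hindep : iIndepFun (fun (i : Fin N) (y : Fin N → E) => g (y i)) P :=
    iIndepFun_pi (μ := fun _ : Fin N => μ) (X := fun _ : Fin N => g) fun _ => hg.aemeasurable
  have hmgf_i : ∀ i : Fin N, mgf (fun y : Fin N → E => g (y i)) P l ≤ Real.exp (a * (Real.exp l - 1)) := by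
    intro i
    have hid : mgf (fun y : Fin N → E => g (y i)) P l = mgf g μ l :=
      integral_comp_eval_pi μ i (Real.measurable_exp.comp (hg.const_mul l)).aestronglyMeasurable
    rw [hid]
    exact mgf_le_exp_of_mem_Icc μ hg h01 l
  have hsum : (∑ i : Fin N, fun y : Fin N → E => g (y i)) = fun y => ∑ i, g (y i) := by
    funext y
    rw [Finset.sum_apply]
  have hmgf : mgf (fun y : Fin N → E => ∑ i, g (y i)) P l ≤ Real.exp (N * (a * (Real.exp l - 1))) := by
    rw [← hsum, hindep.mgf_sum₀ (fun i => (hg.comp (measurable_pi_apply i)).aemeasurable) univ]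
    calc ∏ i, mgf (fun y : Fin N → E => g (y i)) P l ≤ ∏ _i : Fin N, Real.exp (a * (Real.exp l - 1)) :=
          Finset.prod_le_prod (fun i _ => mgf_nonneg) fun i _ => hmgf_i i
      _ = Real.exp (N * (a * (Real.exp l - 1))) := by
          rw [Finset.prod_const, card_univ, Fintype.card_fin, ← Real.exp_nat_mul]
  -- integrability of `e^{l S}` (bounded by `e^{l N}`)
  have hSm : Measurable fun y : Fin N → E => ∑ i, g (y i) :=
    Finset.measurable_sum _ fun i _ => hg.comp (measurable_pi_apply i)
  have hSint : Integrable (fun y : Fin N → E => Real.exp (l * ∑ i, g (y i))) P := by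
    refine Integrable.of_bound (Real.measurable_exp.comp (hSm.const_mul l)).aestronglyMeasurable
      (Real.exp (l * N)) (Eventually.of_forall fun y => ?_)
    rw [Real.norm_eq_abs, abs_of_nonneg (Real.exp_pos _).le, Real.exp_le_exp]
    refine mul_le_mul_of_nonneg_left ?_ hl0.le
    calc ∑ i, g (y i) ≤ ∑ _i : Fin N, (1 : ℝ) := Finset.sum_le_sum fun i _ => (h01 (y i)).2
      _ = N := by rw [Finset.sum_const, card_univ, Fintype.card_fin, nsmul_eq_mul, mul_one]
  -- Chernoff
  have hcher := measure_ge_le_exp_mul_mgf (μ := P) (X := fun y : Fin N → E => ∑ i, g (y i))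
    (N * (a + t)) hl0.le hSint
  -- the event `{t ≤ X̄ − a}` is the event `{N (a + t) ≤ Σ g}`
  have hNpos : (0 : ℝ) < N := by exact_mod_cast hN
  have hset : {y : Fin N → E | t ≤ sampleMean g y - a} = {y | (N : ℝ) * (a + t) ≤ ∑ i, g (y i)} := by
    ext y
    simp only [mem_setOf_eq, sampleMean]
    rw [le_sub_iff_add_le, le_div_iff₀ hNpos, mul_comm, add_comm]
  rw [hset]
  refine hcher.trans ?_
  calc Real.exp (-l * (N * (a + t))) * mgf (fun y : Fin N → E => ∑ i, g (y i)) P l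
      ≤ Real.exp (-l * (N * (a + t))) * Real.exp (N * (a * (Real.exp l - 1))) :=
        mul_le_mul_of_nonneg_left hmgf (Real.exp_pos _).le
    _ = Real.exp (-(N * ((a + t) * Real.log (1 + t / a) - t))) := by
        rw [← Real.exp_add, hexpl, ← hl]
        congr 1
        field_simp
        ring

/-- **Bernstein upper tail**: for a measurable `g` with values in `[0,1]` and mean `a`, `N ≥ 1`
i.i.d. records and `t > 0`, `μ^{⊗N} {(1/N) Σ_i g(y i) − a ≥ t} ≤ exp(−N t²/(2(a + t/3)))`. -/
theorem measureReal_sampleMean_sub_ge_le_exp_bernstein {g : E → ℝ} (hg : Measurable g)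
    (h01 : ∀ a, g a ∈ Icc (0 : ℝ) 1) {N : ℕ} (hN : 0 < N) {t : ℝ} (ht : 0 < t) :
    (Measure.pi fun _ : Fin N => μ).real {y | t ≤ sampleMean g y - ∫ a, g a ∂μ} ≤
      Real.exp (-(N * t ^ 2 / (2 * ((∫ a, g a ∂μ) + t / 3)))) := by
  set P := Measure.pi fun _ : Fin N => μ with hP
  have hint : Integrable g μ := Integrable.of_mem_Icc 0 1 hg.aemeasurable (Eventually.of_forall h01)
  have ha0 : 0 ≤ ∫ a, g a ∂μ := integral_nonneg fun a => (h01 a).1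
  rcases ha0.eq_or_lt with ha | ha
  · -- degenerate case `a = 0`: `g = 0` a.e., so `X̄ = 0` a.s. and the event is null
    have hg0 : g =ᵐ[μ] 0 := (integral_eq_zero_iff_of_nonneg (fun a => (h01 a).1) hint).1 ha.symm
    have hall : ∀ᵐ y ∂P, ∀ i : Fin N, g (y i) = 0 := by
      rw [ae_all_iff]
      intro i
      exact (measurePreserving_eval (fun _ : Fin N => μ) i).quasiMeasurePreserving.ae_eq_comp hg0
    have hnull : P.real {y | t ≤ sampleMean g y - ∫ a, g a ∂μ} = 0 := by
      rw [measureReal_def, ENNReal.toReal_eq_zero_iff]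
      left
      refine measure_eq_zero_iff_ae_notMem.2 (hall.mono fun y hy hmem => ?_)
      simp only [mem_setOf_eq, sampleMean, hy, Finset.sum_const_zero, zero_div, ← ha, sub_zero] at hmem
      exact absurd hmem (not_le.2 ht)
    rw [hnull]
    exact (Real.exp_pos _).le
  · refine (measureReal_sampleMean_sub_ge_le_exp_bennett μ hg h01 hN ht ha).trans ?_
    rw [Real.exp_le_exp, neg_le_neg_iff, mul_div_assoc]
    exact mul_le_mul_of_nonneg_left (sq_div_le_bennettExponent ha ht.le) (Nat.cast_nonneg N)

/-- **Bernstein lower tail**: `μ^{⊗N} {a − (1/N) Σ_i g(y i) ≥ t} ≤ exp(−N t²/(2(1 − a + t/3)))`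
(the upper tail of `1 − g`, whose mean is `1 − a`). -/
theorem measureReal_sub_sampleMean_ge_le_exp_bernstein {g : E → ℝ} (hg : Measurable g)
    (h01 : ∀ a, g a ∈ Icc (0 : ℝ) 1) {N : ℕ} (hN : 0 < N) {t : ℝ} (ht : 0 < t) :
    (Measure.pi fun _ : Fin N => μ).real {y | t ≤ (∫ a, g a ∂μ) - sampleMean g y} ≤
      Real.exp (-(N * t ^ 2 / (2 * ((1 - ∫ a, g a ∂μ) + t / 3)))) := by
  have h01' : ∀ a, 1 - g a ∈ Icc (0 : ℝ) 1 := fun a => by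
    have := h01 a
    simp only [Set.mem_Icc] at this ⊢
    constructor <;> linarith
  have h := measureReal_sampleMean_sub_ge_le_exp_bernstein μ (g := fun a => 1 - g a)
    (measurable_const.sub hg) h01' hN ht
  have hint : ∫ a, (1 - g a) ∂μ = 1 - ∫ a, g a ∂μ := by
    rw [integral_sub (integrable_const 1) (Integrable.of_mem_Icc 0 1 hg.aemeasurable
      (Eventually.of_forall h01)), integral_const, smul_eq_mul, probReal_univ, one_mul]
  have hN' : (N : ℝ) ≠ 0 := by exact_mod_cast hN.ne'
  have hsm : ∀ y : Fin N → E, sampleMean (fun a => 1 - g a) y = 1 - sampleMean g y := fun y => by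
    unfold sampleMean
    rw [sum_sub_distrib, sum_const, card_univ, Fintype.card_fin, nsmul_eq_mul, mul_one]
    field_simp
  have hset : {y : Fin N → E | t ≤ sampleMean (fun a => 1 - g a) y - ∫ a, (1 - g a) ∂μ} =
      {y | t ≤ (∫ a, g a ∂μ) - sampleMean g y} := by
    ext y
    simp only [mem_setOf_eq, hsm y, hint]
    constructor <;> intro h <;> linarith
  rw [hset, hint] at h
  exact h

end IID

/-! ## For a Crooks pair: relative-error confidence for the reported mean acceptance -/

namespace CrooksPair

variable {Ω : Type*} [MeasurableSpace Ω]
variable {ν₀ ν₁ : Measure Ω} {κF κR : Kernel Ω E} {s e : E → Ω} {W : E → ℝ}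

/-- **Bernstein upper tail for the reported acceptance.**  For every Crooks pair, every level
constant `c`, `N ≥ 1` independent forward evolutions from prior equilibrium and `t > 0`: the mean
of the `N` acceptance probabilities `min(1, e^{−(W_i − c)})` exceeds `a_F(c) + t` with probability
at most `exp(−N t²/(2(a_F(c) + t/3)))`. -/
theorem measureReal_sampleMean_accept_sub_ge_le_exp [IsFiniteMeasure ν₀] [IsMarkovKernel κF]
    (h0 : ν₀ univ ≠ 0) (h : CrooksPair ν₀ ν₁ κF κR s e W) (c : ℝ) {N : ℕ} (hN : 0 < N) {t : ℝ}
    (ht : 0 < t) :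
    haveI := isProbabilityMeasure_fwdPathLaw ν₀ h0 κF
    (Measure.pi fun _ : Fin N => fwdPathLaw ν₀ κF).real
        {y | t ≤ sampleMean (fun ε => min 1 (Real.exp (-(W ε - c)))) y -
          ∫ ε, min 1 (Real.exp (-(W ε - c))) ∂(fwdPathLaw ν₀ κF)} ≤
      Real.exp (-(N * t ^ 2 / (2 * ((∫ ε, min 1 (Real.exp (-(W ε - c))) ∂(fwdPathLaw ν₀ κF)) + t / 3)))) := by
  haveI := isProbabilityMeasure_fwdPathLaw ν₀ h0 κF
  exact measureReal_sampleMean_sub_ge_le_exp_bernstein (fwdPathLaw ν₀ κF)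
    (g := fun ε => min 1 (Real.exp (-(W ε - c))))
    (measurable_const.min (Real.measurable_exp.comp (h.measurable_W.sub measurable_const).neg))
    (fun ε => ⟨le_min zero_le_one (Real.exp_pos _).le, min_le_left _ _⟩) hN ht

/-- **Bernstein lower tail for the reported acceptance**: the mean acceptance falls below
`a_F(c) − t` with probability at most `exp(−N t²/(2(1 − a_F(c) + t/3)))`. -/
theorem measureReal_accept_sub_sampleMean_ge_le_exp [IsFiniteMeasure ν₀] [IsMarkovKernel κF]
    (h0 : ν₀ univ ≠ 0) (h : CrooksPair ν₀ ν₁ κF κR s e W) (c : ℝ) {N : ℕ} (hN : 0 < N) {t : ℝ}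
    (ht : 0 < t) :
    haveI := isProbabilityMeasure_fwdPathLaw ν₀ h0 κF
    (Measure.pi fun _ : Fin N => fwdPathLaw ν₀ κF).real
        {y | t ≤ (∫ ε, min 1 (Real.exp (-(W ε - c))) ∂(fwdPathLaw ν₀ κF)) -
          sampleMean (fun ε => min 1 (Real.exp (-(W ε - c)))) y} ≤
      Real.exp (-(N * t ^ 2 /
        (2 * ((1 - ∫ ε, min 1 (Real.exp (-(W ε - c))) ∂(fwdPathLaw ν₀ κF)) + t / 3)))) := by
  haveI := isProbabilityMeasure_fwdPathLaw ν₀ h0 κF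
  exact measureReal_sub_sampleMean_ge_le_exp_bernstein (fwdPathLaw ν₀ κF)
    (g := fun ε => min 1 (Real.exp (-(W ε - c))))
    (measurable_const.min (Real.measurable_exp.comp (h.measurable_W.sub measurable_const).neg))
    (fun ε => ⟨le_min zero_le_one (Real.exp_pos _).le, min_le_left _ _⟩) hN ht

/-- **Relative-error form**: `P{ᾱ_N ≥ (1 + ε) a_F(c)} ≤ exp(−N a_F(c) ε²/(2(1 + ε/3)))` for `ε > 0`
— the number of ACCEPTED proposals `N a_F(c)`, not `N`, must be large to certify a small
acceptance to relative accuracy `ε`. -/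
theorem measureReal_sampleMean_accept_ge_mul_le_exp [IsFiniteMeasure ν₀] [IsMarkovKernel κF]
    (h0 : ν₀ univ ≠ 0) (h : CrooksPair ν₀ ν₁ κF κR s e W) (c : ℝ) {N : ℕ} (hN : 0 < N) {ε : ℝ}
    (hε : 0 < ε) :
    haveI := isProbabilityMeasure_fwdPathLaw ν₀ h0 κF
    (Measure.pi fun _ : Fin N => fwdPathLaw ν₀ κF).real
        {y | (1 + ε) * ∫ x, min 1 (Real.exp (-(W x - c))) ∂(fwdPathLaw ν₀ κF) ≤
          sampleMean (fun x => min 1 (Real.exp (-(W x - c)))) y} ≤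
      Real.exp (-(N * (∫ x, min 1 (Real.exp (-(W x - c))) ∂(fwdPathLaw ν₀ κF)) * ε ^ 2 /
        (2 * (1 + ε / 3)))) := by
  haveI := isProbabilityMeasure_fwdPathLaw ν₀ h0 κF
  set a := ∫ x, min 1 (Real.exp (-(W x - c))) ∂(fwdPathLaw ν₀ κF) with hadef
  have ha : 0 < a := by
    have hsupp : Function.support (fun x => min 1 (Real.exp (-(W x - c)))) = univ := by
      ext x
      simp only [Function.mem_support, mem_univ, iff_true]
      exact (lt_min zero_lt_one (Real.exp_pos _)).ne'
    have hp := (integral_pos_iff_support_of_nonneg (μ := fwdPathLaw ν₀ κF)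
      (f := fun x => min 1 (Real.exp (-(W x - c)))) (fun x => le_min zero_le_one (Real.exp_pos _).le)
      (h.integrable_accept h0 c)).2 (by rw [hsupp, measure_univ]; exact one_pos)
    rw [hadef]
    exact hp
  have key := h.measureReal_sampleMean_accept_sub_ge_le_exp h0 c hN (mul_pos hε ha)
  have hset : {y : Fin N → E | (1 + ε) * a ≤ sampleMean (fun x => min 1 (Real.exp (-(W x - c)))) y} =
      {y | ε * a ≤ sampleMean (fun x => min 1 (Real.exp (-(W x - c)))) y - a} := by
    ext y
    simp only [mem_setOf_eq]
    constructor <;> intro hy <;> linarith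
  have hexp : (N : ℝ) * (ε * a) ^ 2 / (2 * (a + ε * a / 3)) = N * a * ε ^ 2 / (2 * (1 + ε / 3)) := by
    field_simp
  rw [hset, ← hexp]
  exact key

end CrooksPair

end Summit.Ventures.LatticeQCDFlow.Exactness.GeneralNCMC
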